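import Summits.BirchSwinnertonDyer.BirchSwinnertonDyer.Theorems.ErratumRoadFiveEulerHalfGenusFrameTwistSupply
import HarnessLib

/-!
# Euler-system half at `p ≥ 5`, crux `ErratumRoadFive.EulerHalfNotRamNoInertSetAtFive` (item stmt-BirchSwinnertonDyer-19715), crux idea
# `ramified-twin-ram-transport` — the GENUS FRAME'S TWIST SUPPLY, part 3: the supply IN THE FRAME PREDICATE'S SHAPE (free ramified prime
# `ℓ₀ ∤ N_E`, «the bad primes of `d_K` are `{q}`», `d_K` odd `< 0`), for the LEAD's TURNKEY stub S1 `stub_supplyRC`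

Width seat `bsd-line-er5-p1-w6` g9 (cell `bsd-stepL`); helper `--supports stmt-BirchSwinnertonDyer-19715`; THEOREMS ONLY (no definition, no named fact,
no `sorry`). Sequel of parts 1–2 (`…GenusFrameArith`, `…GenusFrameTwistSupply`: `genusFrameTwistSupply_of_hoffsteinLuo`).

The LEAD's memo rev 1.2 §8 (HOME/line-er5-p1/lead/g7/LEAD-ASSESS-ramified-twin-g7.md) fixes the FRAME PREDICATE of the served-class road
`EulerHalfPOnlyMultPotMultTwinAtFive` (transposed from bsd-addord's `RamifiedKolyvaginFieldM`, their `p` ↦ our `q`): `K` imaginary quadratic, `d_K` odd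
`< −4`, `q ∣ d_K`, every prime `ℓ ∣ N_W` with `ℓ ≠ q` split in `K`, ONE FREE RAMIFIED PRIME `ℓ₀ ∤ N_W` (the hypothesis of -w7's genus Heegner point
p665860: Gross's factorisation needs two proper genus factors), twin `Wd = (W^{(d_K)})_min` NON-SPLIT multiplicative at `q`; S1 `stub_supplyRC` = «∃ K in
the frame with `L(W^{(d_K)},1) ≠ 0`». Part 2's landed theorem hides the auxiliary prime `ℓ₀` inside its `∃`; this file re-runs part 2's §5 assembly
(over the landed §3 `exists_pos_twist_L_ne_zero` and §4 `exists_auxTwist_rootNumber_one`) EXPOSING it: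

* `genusFrameSupply_frame_of_hoffsteinLuo` — for `W/ℚ` globally minimal with `w = −1`, `q ≥ 5` additive potentially multiplicative, any bound `B`:
  `∃ K Wd Cd`, `IsImaginaryQuadratic K`, `B < |d_K|`, `d_K < 0`, `Odd d_K`, `d_K ≡ 1 (mod 8)`, `q ∣ d_K`, `Squarefree d_K`, every bad `ℓ ≠ q`
  split, every bad prime dividing `d_K` equals `q`, a prime `ℓ₀ ≠ q` with `ℓ₀ ∣ d_K` and `ℓ₀ ∤ N_W`, `Cd • W^{(d_K)} = Wd` globally minimal,
  `Wd` multiplicative non-split at `q`, `L(W^{(d_K)},1) ≠ 0` — from `hHL` (Hoffstein–Luo 1997, conjunct of `PublishedInputsFive`) and `hmod`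
  (Modularity) ONLY (take `B = 4` for `d_K < −4`; `p ∣ N_W`, `p ≠ q` ⇒ `p` split).

HONEST FRAMING as in part 2: supply leg only, `q = 3` not covered, no stub exists or is closed, crux 19715 unchanged, BSD proved for no curve.
References: [cite: HoffsteinLuo1997, Theorem (§1, pp. 435–436)] [cite: FriedbergHoffstein1995, Thm. B] [cite: Rohrlich1993Compositio, Prop. 2(ii),(iii)]
[cite: SilvermanAEC2009, X.5 Cor. 5.4, VII.5 Prop. 5.1] [cite: IrelandRosen1990, Ch. 16 §1].
-/

set_option autoImplicit false
-- D-0017: single-problem summit, so `Summit.BirchSwinnertonDyer.BirchSwinnertonDyer.…` repeats the name by design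
set_option linter.dupNamespace false

noncomputable section

open scoped Classical NumberTheorySymbols

namespace Summit.BirchSwinnertonDyer.BirchSwinnertonDyer.Theorems.EulerHalfGenusFrame

open WeierstrassCurve NumberField Literature.NumberTheory.EllipticCurves
  Literature.NumberTheory.EllipticCurves.ModularForms
  Literature.NumberTheory.EllipticCurves.Rank1Residual
  Summit.BirchSwinnertonDyer.Rank1Residual
  Summit.BirchSwinnertonDyer.BirchSwinnertonDyer.Theorems.ThreeFieldRoadSupply

/-- **S1 `stub_supplyRC` content — the genus-frame supply IN THE FRAME PREDICATE'S SHAPE** (free ramified prime exposed; see the module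
docstring for the list of conjuncts). Construction `d_K = q*·ℓ₀*·n` exactly as in part 2's `genusFrameTwistSupply_of_hoffsteinLuo` (landed §§3–4
lemmas reused by name); CONDITIONAL on `hHL` and `hmod` only. [cite: HoffsteinLuo1997, Theorem (§1, pp. 435–436)] [cite: FriedbergHoffstein1995, Thm. B]
[cite: SilvermanAEC2009, X.5 Cor. 5.4, VII.5 Prop. 5.1] [cite: Rohrlich1993Compositio, Prop. 2(ii),(iii)] -/
theorem genusFrameSupply_frame_of_hoffsteinLuo
    (hHL : HoffsteinLuo1997_exists_twist_L_one_ne_zero) (hmod : exists_isNewformOf)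
    (W : WeierstrassCurve ℚ) [W.IsElliptic] [W.IsGloballyMinimal] (hw : W.rootNumber = -1)
    (q : ℕ) [hq : Fact q.Prime] (hq5 : 5 ≤ q) (hadd : Addv W q) (hpm : Additive.PotMult W q) (B : ℕ) :
    ∃ (K : Type) (_ : Field K) (_ : NumberField K) (Wd : WeierstrassCurve ℚ) (_ : Wd.IsElliptic)
      (_ : Wd.IsGloballyMinimal) (Cd : VariableChange ℚ),
      IsImaginaryQuadratic K ∧ B < (NumberField.discr K).natAbs ∧ NumberField.discr K < 0 ∧ Odd (NumberField.discr K) ∧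
      NumberField.discr K % 8 = 1 ∧
      (q : ℤ) ∣ NumberField.discr K ∧ Squarefree (NumberField.discr K) ∧
      (∀ ℓ : ℕ, ℓ.Prime → ℓ ∣ W.conductorNorm ℤ → ℓ ≠ q →
        ((Ideal.span {(ℓ : ℤ)}).primesOver (𝓞 K)).ncard = 2) ∧
      (∀ ℓ : ℕ, ℓ.Prime → ℓ ∣ W.conductorNorm ℤ → (ℓ : ℤ) ∣ NumberField.discr K → ℓ = q) ∧
      (∃ ℓ₀ : ℕ, ℓ₀.Prime ∧ ℓ₀ ≠ q ∧ (ℓ₀ : ℤ) ∣ NumberField.discr K ∧ ¬ ℓ₀ ∣ W.conductorNorm ℤ) ∧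
      Cd • W.quadraticTwist (NumberField.discr K : ℚ) = Wd ∧
      Wd.HasMultiplicativeReductionAtPrime q ∧ ¬ Wd.HasSplitMultiplicativeReductionAtPrime q ∧
      (W.quadraticTwist (NumberField.discr K : ℚ)).entireLFunction 1 ≠ 0 := by
  have hqp : q.Prime := hq.out
  have hq2 : q ≠ 2 := by omega
  have hN0 : W.conductorNorm ℤ ≠ 0 := (W.conductorNorm_pos_holds).ne'
  obtain ⟨M, hN, hqM⟩ := conductorNorm_eq_mul_sq_of_addv W q hq5 hadd
  have hqN : q ∣ W.conductorNorm ℤ := by rw [hN]; exact Dvd.intro (M * q) (by ring)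
  -- the multiplicative twist model at `q` (the potentially multiplicative row)
  obtain ⟨V, _, _, C, hmultV, hC⟩ :=
    AdditivePotMult.PotMult.exists_mult_pStar_twist_model (W := W) (p := q) ⟨hadd, hpm⟩ hq2
  -- the auxiliary prime `ℓ₀` and the auxiliary twist `X₀ = E^{(q*ℓ₀*)}` of root number `+1`
  obtain ⟨ℓ₀, hℓ₀, -, hℓ₀2, hℓ₀q, hℓ₀N, hneg, h8, hJq, hodd, hX₀⟩ :=
    exists_auxTwist_rootNumber_one hmod W hw q hq5 hadd V C hC hmultV 0
  haveI : Fact ℓ₀.Prime := ⟨hℓ₀⟩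
  set qs : ℤ := (-1 : ℤ) ^ (q / 2) * q with hqs
  set ls : ℤ := (-1 : ℤ) ^ (ℓ₀ / 2) * ℓ₀ with hls
  have hD₀0 : qs * ls ≠ 0 := hneg.ne
  have hD₀q : ((qs * ls : ℤ) : ℚ) ≠ 0 := by exact_mod_cast hD₀0
  haveI hX₀E : (W.quadraticTwist ((qs * ls : ℤ) : ℚ)).IsElliptic := W.isElliptic_quadraticTwist hD₀q
  -- Hoffstein–Luo's POSITIVE twisting parameter of `X₀`, split at `ℓ₀` and at the bad primes of `E`
  obtain ⟨n, hnpos, hBn, hnsq, hn8, hJS, -, hL⟩ :=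
    exists_pos_twist_L_ne_zero hHL hmod (W.quadraticTwist ((qs * ls : ℤ) : ℚ)) hX₀
      (insert ℓ₀ (W.conductorNorm ℤ).primeFactors) B
  have hn4 : n % 4 = 1 := by omega
  have hn0 : n ≠ 0 := hnpos.ne'
  have hJbad : ∀ ℓ : ℕ, ℓ.Prime → ℓ ∣ W.conductorNorm ℤ → ℓ ≠ 2 → J(n | ℓ) = 1 := fun ℓ hℓ hℓN hℓ2 ↦
    hJS ℓ (Finset.mem_insert_of_mem (Nat.mem_primeFactors.mpr ⟨hℓ, hℓN, hN0⟩)) hℓ hℓ2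
  have hJnq : J(n | q) = 1 := hJbad q hqp hqN hq2
  have hJnℓ₀ : J(n | ℓ₀) = 1 := hJS ℓ₀ (Finset.mem_insert_self _ _) hℓ₀ hℓ₀2
  have hqn : ¬ (q : ℤ) ∣ n := not_dvd_of_jacobiSym_eq_one hqp hJnq
  have hℓ₀n : ¬ (ℓ₀ : ℤ) ∣ n := not_dvd_of_jacobiSym_eq_one hℓ₀ hJnℓ₀
  -- the discriminant `D = q* ℓ₀* n`
  set D : ℤ := qs * ls * n with hD
  have hDneg : D < 0 := mul_neg_of_neg_of_pos hneg hnpos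
  have hD8 : D % 8 = 1 := by rw [hD, Int.mul_emod, h8, hn8]; norm_num
  have hD4 : D % 4 = 1 := by omega
  have hD1 : D ≠ 1 := by omega
  have hqssq : Squarefree qs := squarefree_pStar (p := q)
  have hlssq : Squarefree ls := squarefree_pStar (p := ℓ₀)
  have hls4 : ls % 4 = 1 := AdditiveKoly.RamifiedHabitat.pStar_emod_four (p := ℓ₀) hℓ₀2
  have hcop1 : IsCoprime qs ls := by
    rw [Int.isCoprime_iff_gcd_eq_one, Int.gcd_eq_natAbs, hqs, hls, natAbs_pStar (p := q), natAbs_pStar (p := ℓ₀)]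
    exact (Nat.coprime_primes hqp hℓ₀).mpr (Ne.symm hℓ₀q)
  have hcop2 : IsCoprime ls n := by
    rw [Int.isCoprime_iff_gcd_eq_one, Int.gcd_eq_natAbs, hls, natAbs_pStar (p := ℓ₀)]
    exact (Nat.Prime.coprime_iff_not_dvd hℓ₀).mpr (fun h ↦ hℓ₀n (Int.natCast_dvd.mpr h))
  have hcop3 : IsCoprime qs n := by
    rw [Int.isCoprime_iff_gcd_eq_one, Int.gcd_eq_natAbs, hqs, natAbs_pStar (p := q)]
    exact (Nat.Prime.coprime_iff_not_dvd hqp).mpr (fun h ↦ hqn (Int.natCast_dvd.mpr h))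
  have husq : Squarefree (ls * n) := squarefree_mul_iff.mpr ⟨hcop2.isRelPrime, hlssq, hnsq⟩
  have hDsq : Squarefree D := by
    rw [hD, mul_assoc]
    exact squarefree_mul_iff.mpr ⟨(hcop1.mul_right hcop3).isRelPrime, hqssq, husq⟩
  have hBD : B < D.natAbs := by
    have h1 : n.natAbs ≤ D.natAbs := by
      rw [hD, Int.natAbs_mul]
      exact Nat.le_mul_of_pos_left _ (Int.natAbs_pos.mpr hD₀0)
    have h2 : (n.natAbs : ℤ) = n := Int.natAbs_of_nonneg hnpos.le
    omega
  -- bad primes `≠ q` divide `M`, and `(D/ℓ) = 1` there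
  have hbadM : ∀ ℓ : ℕ, ℓ.Prime → ℓ ∣ W.conductorNorm ℤ → ℓ ≠ q → ℓ ∣ M := by
    intro ℓ hℓ hℓN hℓq
    rw [hN] at hℓN
    rcases (Nat.Prime.dvd_mul hℓ).mp hℓN with h | h
    · exact h
    · exact absurd ((Nat.prime_dvd_prime_iff_eq hℓ hqp).mp (hℓ.dvd_of_dvd_pow h)) hℓq
  have hMN : ∀ ℓ : ℕ, ℓ ∣ M → ℓ ∣ W.conductorNorm ℤ := fun ℓ h ↦ by rw [hN]; exact h.mul_right _
  have hkron : ∀ p : ℕ, p.Prime → p ∣ M → (p = 2 → D % 8 = 1) ∧ (p ≠ 2 → jacobiSym D p = 1) := by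
    intro p hp hpM
    refine ⟨fun _ ↦ hD8, fun hp2 ↦ ?_⟩
    have hpq : p ≠ q := by rintro rfl; exact hqM hpM
    rw [hD, jacobiSym.mul_left, hodd p hp (hMN p hpM) hpq hp2, hJbad p hp (hMN p hpM) hp2, one_mul]
  -- the field
  obtain ⟨K, _, _, hK, hBK, hHM, hdK⟩ :=
    (exists_heegnerField_iff_exists_fundamental M B (fun D' ↦ D' = D)).mpr
      ⟨D, hDneg, Or.inl ⟨hD4, hDsq, hD1⟩, hBD, hkron, rfl⟩
  -- the twin's global minimal model
  have hDq0 : ((D : ℤ) : ℚ) ≠ 0 := by exact_mod_cast hDneg.ne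
  haveI hXDE : (W.quadraticTwist ((D : ℤ) : ℚ)).IsElliptic := W.isElliptic_quadraticTwist hDq0
  obtain ⟨Cd, hCd⟩ := hasGlobalMinimalModel_rat_holds (W.quadraticTwist ((D : ℤ) : ℚ))
  set Wd : WeierstrassCurve ℚ := Cd • W.quadraticTwist ((D : ℤ) : ℚ) with hWd_def
  haveI : Wd.IsGloballyMinimal := hCd
  -- `Wd ≅ V^{(u)}`, `u = ℓ₀* n`
  set u : ℤ := ls * n with hu
  have hu0 : u ≠ 0 := mul_ne_zero (by rw [hls]; exact mul_ne_zero (pow_ne_zero _ (by norm_num)) (by exact_mod_cast hℓ₀.ne_zero)) hn0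
  have hu0q : ((u : ℤ) : ℚ) ≠ 0 := by exact_mod_cast hu0
  have hqu : ¬ (q : ℤ) ∣ u := by
    rw [hu]; intro h
    rcases Int.Prime.dvd_mul' hqp h with h | h
    · apply hℓ₀q
      have h' : (q : ℤ) ∣ (ℓ₀ : ℤ) := by
        have hu' : IsUnit ((-1 : ℤ) ^ (ℓ₀ / 2)) := (isUnit_neg_one (α := ℤ)).pow _
        rw [hls] at h; exact (hu'.dvd_mul_left).mp h
      exact ((Nat.prime_dvd_prime_iff_eq hqp hℓ₀).mp (Int.natCast_dvd_natCast.mp h')).symm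
    · exact hqn h
  set qs' : ℚ := (-1 : ℚ) ^ (q / 2) * q with hqs'
  have hqs'0 : qs' ≠ 0 := mul_ne_zero (pow_ne_zero _ (by norm_num)) (by exact_mod_cast hqp.ne_zero)
  have hqscast : ((qs : ℤ) : ℚ) = qs' := by rw [hqs, hqs']; push_cast; ring
  haveI := V.isElliptic_quadraticTwist hqs'0
  haveI := V.isElliptic_quadraticTwist hu0q
  obtain ⟨C₂, hC₂⟩ := V.exists_variableChange_quadraticTwist_mul_sq ((u : ℤ) : ℚ) qs' hqs'0
  have hWD : W.quadraticTwist ((D : ℤ) : ℚ) =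
      ((⟨C.u, ((D : ℤ) : ℚ) * C.r, 0, 0⟩ : VariableChange ℚ) * C₂) • V.quadraticTwist ((u : ℤ) : ℚ) := by
    have hDcast : qs' * ((D : ℤ) : ℚ) = ((u : ℤ) : ℚ) * qs' ^ 2 := by
      rw [← hqscast, hD, hu]; push_cast; ring
    rw [← hC, WeierstrassCurve.quadraticTwist_smul, quadraticTwist_quadraticTwist, hDcast, ← hC₂, mul_smul]
  have hWdV : (Cd * (⟨C.u, ((D : ℤ) : ℚ) * C.r, 0, 0⟩ : VariableChange ℚ) * C₂) • V.quadraticTwist ((u : ℤ) : ℚ) = Wd := by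
    rw [hWd_def, hWD, mul_assoc, mul_smul]
  have hmultWd : Wd.HasMultiplicativeReductionAtPrime q := by
    rw [← hWdV, Literature.NumberTheory.EllipticCurves.hasMultiplicativeReductionAtPrime_smul_iff]
    exact (GenusGrossZagier.hasMultiplicativeReductionAtPrime_quadraticTwist_iff_of_odd V hq2 hu0 hqu).mpr hmultV
  -- … and NON-SPLIT
  have hu4 : u % 4 = 1 := by rw [hu, Int.mul_emod, hls4, hn4]; norm_num
  have hu1 : u ≠ 1 := by
    rw [hu]; intro h
    have habs : ls.natAbs * n.natAbs = 1 := by rw [← Int.natAbs_mul, h]; rfl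
    have hℓ₀abs : ls.natAbs = ℓ₀ := by rw [hls]; exact natAbs_pStar (p := ℓ₀)
    rw [hℓ₀abs] at habs
    exact hℓ₀.one_lt.ne' (Nat.eq_one_of_mul_eq_one_right habs)
  have hJu : J(u | q) = (if V.HasSplitMultiplicativeReductionAtPrime q then -1 else 1) := by
    rw [hu, jacobiSym.mul_left, hJq, hJnq, mul_one]
  have hnsWd : ¬ Wd.HasSplitMultiplicativeReductionAtPrime q := by
    by_cases hsV : V.HasSplitMultiplicativeReductionAtPrime q
    · -- `(u/q) = −1`: the twist of the split `V` is non-split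
      rw [if_pos hsV] at hJu
      obtain ⟨Ku, _, _, _, hdu⟩ :=
        Literature.NumberTheory.QuadraticFields.Quadratic.exists_numberField_discr_eq (D := u) (Or.inl ⟨hu4, husq, hu1⟩)
      have key := X11b.Three.split_twist_iff_not_split_of_jacobiSym V Ku (Wd := Wd)
        (Cd * (⟨C.u, ((D : ℤ) : ℚ) * C.r, 0, 0⟩ : VariableChange ℚ) * C₂) (by rw [hdu]; exact hWdV) q hq2
        (by rw [hdu]; exact hJu) hmultV
      exact fun h ↦ (key.mp h) hsV
    · -- `(u/q) = +1`: the twist of the non-split `V` is non-split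
      rw [if_neg hsV] at hJu
      have hsq : IsSquare (((u : ℤ) : ℚ) : ℚ_[q]) :=
        isSquare_padic_of_fundamental hu4 husq hu1 ⟨fun h2 ↦ absurd h2 hq2, fun _ ↦ hJu⟩
      have hsq' : IsSquare (algebraMap ℚ ℚ_[q] ((u : ℤ) : ℚ)) := by simpa using hsq
      rw [← hWdV, Literature.NumberTheory.EllipticCurves.hasSplitMultiplicativeReductionAtPrime_smul_iff,
        V.hasSplitMultiplicativeReductionAtPrime_quadraticTwist_iff hu0q hsq']
      exact hsV
  have hLD : (W.quadraticTwist ((D : ℤ) : ℚ)).entireLFunction 1 ≠ 0 := by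
    have : ((D : ℤ) : ℚ) = ((qs * ls : ℤ) : ℚ) * (n : ℚ) := by rw [hD]; push_cast; ring
    rw [this, ← quadraticTwist_quadraticTwist]
    exact hL
  refine ⟨K, inferInstance, inferInstance, Wd, inferInstance, hCd, Cd, hK, hBK, ?_, ?_, ?_, ?_, ?_, ?_, ?_, ?_, ?_, hmultWd, hnsWd, ?_⟩
  · rw [hdK]; exact hDneg
  · rw [hdK]; exact Int.odd_iff.mpr (by omega)
  · rw [hdK]; exact hD8
  · rw [hdK]; exact ⟨(-1 : ℤ) ^ (q / 2) * (ls * n), by rw [hD, hqs]; ring⟩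
  · rw [hdK]; exact hDsq
  · intro ℓ hℓ hℓN hℓq
    exact hHM ℓ hℓ (hbadM ℓ hℓ hℓN hℓq)
  · intro ℓ hℓ hℓN hℓD
    rw [hdK] at hℓD
    by_contra hℓq
    by_cases hℓ2 : ℓ = 2
    · subst hℓ2
      omega
    · exact not_dvd_of_jacobiSym_eq_one hℓ ((hkron ℓ hℓ (hbadM ℓ hℓ hℓN hℓq)).2 hℓ2) hℓD
  · refine ⟨ℓ₀, hℓ₀, hℓ₀q, ?_, hℓ₀N⟩
    rw [hdK]; exact ⟨qs * (-1 : ℤ) ^ (ℓ₀ / 2) * n, by rw [hD, hls]; ring⟩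
  · rw [hdK]
  · rw [hdK]; exact hLD


end Summit.BirchSwinnertonDyer.BirchSwinnertonDyer.Theorems.EulerHalfGenusFrame

end
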